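import Mathlib
import HarnessLib
import Summits.Ventures.LatticeQCDFlow.Exactness.CPNSiteConditional
import Summits.Ventures.LatticeQCDFlow.Exactness.CPNLinkConditional
import Summits.Ventures.LatticeQCDFlow.Exactness.CPNMetropolisSweepErgodic
import Summits.Ventures.LatticeQCDFlow.Exactness.AdjointKernels

/-!
# The `cpn_2d` over-relaxation moves (site and link reflections through the local field) are exact; the heat-bath / Metropolis + over-relaxation composites converge to the lattice CP(N−1) law

HONEST FRAMING: exact (Metropolis-corrected) sampling algorithms for lattice gauge theory;
figures of merit are autocorrelation/cost numbers at stated couplings and volumes; no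
continuum-physics claim.

Venture `LatticeQCDFlow` (cell pub-lqcd), topic `Exactness`, FANOUT row 9 (eng-latcore, the
engine `latflow.core.cpn_2d`: `overrelax_sites` `z ↦ 2 Re(F†z)/|F|² F − z` (keep `z` if `F = 0`),
`overrelax_links` `u ↦ (G/|G|)² ū` (keep `u` if `G = 0`), `composite_sweep` = one `'hb'`/`'metro'`
sweep followed by `n_or` over-relaxation sweeps).  NEW WORK of the cell over Mathlib
(`Submodule.reflection`, `starProjection_singleton`, `stdGaussian_map`, `lmarginal`) and the tree
(gen-12 `CPNHeatBathErgodic` / `CPNSiteConditional` / `CPNLinkConditional`: `cpnAction`,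
`cpnGibbsLaw`, `cpnLocalField`, `cpnStaple`, `gibbsDensity_cpnAction_update(_link)`,
`cpn_heatBathSweep_comp_uniformlyErgodic`; gen-15 `CPNMetropolisSweepErgodic`:
`cpn_metropolisSweep_comp_uniformlyErgodic`; `InvariantComposition` (`cycle`, `invariant_cycle`),
`AdjointKernels` (`isMarkovKernel_cycle`), `RefreshScan` (`lintegral_pi_lmarginal`),
`StdGaussianRadial` (`stdGaussian_map_dirSphere`)).  Nothing is cited as a fact.  Printed
counterparts, NAMED ONLY: Adler 1981 / Creutz 1987 / Brown–Woch 1987 (over-relaxation).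
`TYPED-EXACTNESS-MAP.md` after gen-15 listed "cpn_2d 'metro'∘'or' instance (generic comp theorem
landed, instance not written)" — written here, for the heat-bath composite too.

* §1 (generic `Π j, X j`, probability references `μ_j`): `siteUpdateMap i r` — overwrite coordinate
  `i` by `r ω (ω i)`, `r` reading only the other coordinates; **`siteUpdateMap_invariant`** — if each
  `r ω` preserves `μ_i` and the density along the fibre, the deterministic kernel leaves `p · ⊗μ`
  invariant (Tonelli along coordinate `i`).
* §2 (`ℝ^m`): `reflectThroughLine F x = 2⟪F,x⟫/‖F‖² F − x` (`= x` if `F = 0`) — the engine's formula,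
  `= (ℝ ∙ F).reflection` for `F ≠ 0`; norm and `⟪·, F⟫` preserved, involutive, jointly measurable;
  `sphereReflect`; **`uniformSphere_map_sphereReflect`** (the uniform law is invariant).
* §3 `cpnSiteOR v`, `cpnLinkOR e` (deterministic kernels), **`cpnSiteOR_invariant`** (no self-loops),
  **`cpnLinkOR_invariant`** — EXACT for `e^{−S} · ⊗ cpnRef`; `cpnORSweep l` (any schedule of sites and
  links), `cpnORSweep_invariant`, Markov.
* §4 **`cpn_heatBath_overrelax_uniformlyErgodic`**, **`cpn_metropolis_overrelax_uniformlyErgodic`** — a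
  heat-bath (resp. Metropolis) scan through every site and link followed by ANY over-relaxation
  schedule converges to `cpnGibbsLaw` from EVERY initial law: `∃ ε ∈ (0,1]`, `|μ₀Kᵗ(A) − π(A)| ≤ (1−ε)ᵗ`.

NOT CLAIMED: ergodicity of over-relaxation alone (false: it conserves `S`); the Symanzik action;
any useful rate; floating point (the engine's `1e−300` guards are the `F = 0` branch here).
-/

noncomputable section

namespace Summit.Ventures.LatticeQCDFlow.Exactness

open MeasureTheory Measure Metric Set Real ProbabilityTheory Function
open scoped ENNReal InnerProductSpace
/-! ## §1 Deterministic single-site maps preserving the fibre law and the density are exact -/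

section SiteMap

variable {ι : Type*} [DecidableEq ι] [Fintype ι] {X : ι → Type*} [∀ i, MeasurableSpace (X i)]
  {μ : Π i, Measure (X i)} [∀ i, IsProbabilityMeasure (μ i)]

/-- Overwrite coordinate `i` of `ω` by `r ω (ω i)` (`r` may read the whole configuration; in the
applications it reads only the other coordinates). -/
def siteUpdateMap (i : ι) (r : (Π j, X j) → X i → X i) (ω : Π j, X j) : Π j, X j := update ω i (r ω (ω i))

omit [Fintype ι] in
/-- `siteUpdateMap i r` is measurable when `r` is jointly measurable. -/
theorem measurable_siteUpdateMap {i : ι} {r : (Π j, X j) → X i → X i}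
    (hr : Measurable fun p : (Π j, X j) × X i => r p.1 p.2) : Measurable (siteUpdateMap i r) := by
  have h : siteUpdateMap i r = (fun p : (Π j, X j) × X i => update p.1 i p.2) ∘
      fun ω => (ω, r ω (ω i)) := rfl
  rw [h]
  exact measurable_update'.comp (measurable_id.prodMk (hr.comp (measurable_id.prodMk (measurable_pi_apply i))))

omit [Fintype ι] [∀ i, MeasurableSpace (X i)] in
/-- Along the fibre of coordinate `i`, `siteUpdateMap` acts by `r ω` (when `r` does not read coordinate `i`). -/
theorem siteUpdateMap_update {i : ι} {r : (Π j, X j) → X i → X i} (hext : ∀ ω ξ, r (update ω i ξ) = r ω)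
    (ω : Π j, X j) (ξ : X i) : siteUpdateMap i r (update ω i ξ) = update ω i (r ω ξ) := by
  rw [siteUpdateMap, hext, update_self, update_idem]

/-- **Tonelli along one coordinate**: if every `r ω` preserves `μ_i` and the density along the fibre,
`∫ g(siteUpdateMap ω) p(ω) d⊗μ = ∫ g p d⊗μ` for every measurable `g ≥ 0`. -/
theorem lintegral_comp_siteUpdateMap_mul {i : ι} {r : (Π j, X j) → X i → X i}
    (hr : Measurable fun p : (Π j, X j) × X i => r p.1 p.2) (hext : ∀ ω ξ, r (update ω i ξ) = r ω)
    (hμ : ∀ ω, (μ i).map (r ω) = μ i) {p : (Π j, X j) → ℝ≥0∞} (hp : Measurable p)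
    (hpres : ∀ ω ξ, p (update ω i (r ω ξ)) = p (update ω i ξ)) {g : (Π j, X j) → ℝ≥0∞}
    (hg : Measurable g) :
    ∫⁻ ω, g (siteUpdateMap i r ω) * p ω ∂Measure.pi μ = ∫⁻ ω, g ω * p ω ∂Measure.pi μ := by
  have hgs : Measurable fun ω => g (siteUpdateMap i r ω) * p ω := (hg.comp (measurable_siteUpdateMap hr)).mul hp
  have hgp : Measurable fun ω => g ω * p ω := hg.mul hp
  rw [← lintegral_pi_lmarginal (μ := μ) i hgs, ← lintegral_pi_lmarginal (μ := μ) i hgp]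
  refine lintegral_congr fun ω => ?_
  rw [lmarginal_singleton, lmarginal_singleton]
  have hrω : Measurable (r ω) := by
    have h : r ω = (fun p : (Π j, X j) × X i => r p.1 p.2) ∘ fun ξ => (ω, ξ) := rfl
    rw [h]
    exact hr.comp (measurable_const.prodMk measurable_id)
  have hh : Measurable fun ξ => g (update ω i ξ) * p (update ω i ξ) :=
    (hg.comp (measurable_update ω)).mul (hp.comp (measurable_update ω))
  calc ∫⁻ ξ, g (siteUpdateMap i r (update ω i ξ)) * p (update ω i ξ) ∂μ i
      = ∫⁻ ξ, g (update ω i (r ω ξ)) * p (update ω i (r ω ξ)) ∂μ i := by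
        refine lintegral_congr fun ξ => ?_
        rw [siteUpdateMap_update hext, hpres]
    _ = ∫⁻ ξ, g (update ω i ξ) * p (update ω i ξ) ∂((μ i).map (r ω)) := (lintegral_map hh hrω).symm
    _ = ∫⁻ ξ, g (update ω i ξ) * p (update ω i ξ) ∂μ i := by rw [hμ]

/-- **A deterministic single-site map preserving the fibre law and the density is exact**: the
deterministic kernel of `siteUpdateMap i r` leaves `p · ⊗μ` invariant. -/
theorem siteUpdateMap_invariant {i : ι} {r : (Π j, X j) → X i → X i}
    (hr : Measurable fun p : (Π j, X j) × X i => r p.1 p.2) (hext : ∀ ω ξ, r (update ω i ξ) = r ω)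
    (hμ : ∀ ω, (μ i).map (r ω) = μ i) {p : (Π j, X j) → ℝ≥0∞} (hp : Measurable p)
    (hpres : ∀ ω ξ, p (update ω i (r ω ξ)) = p (update ω i ξ)) :
    Kernel.Invariant (Kernel.deterministic (siteUpdateMap i r) (measurable_siteUpdateMap hr))
      ((Measure.pi μ).withDensity p) := by
  change Kernel.deterministic (siteUpdateMap i r) (measurable_siteUpdateMap hr) ∘ₘ (Measure.pi μ).withDensity p =
    (Measure.pi μ).withDensity p
  rw [Measure.deterministic_comp_eq_map]
  ext A hA
  rw [Measure.map_apply (measurable_siteUpdateMap hr) hA, withDensity_apply _ (measurable_siteUpdateMap hr hA),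
    withDensity_apply _ hA, ← lintegral_indicator (measurable_siteUpdateMap hr hA), ← lintegral_indicator hA]
  have hind : ∀ (B : Set (Π j, X j)) (ω : Π j, X j),
      B.indicator p ω = B.indicator (1 : (Π j, X j) → ℝ≥0∞) ω * p ω := fun B ω => by
    by_cases h : ω ∈ B <;> simp [h]
  simp_rw [hind]
  exact lintegral_comp_siteUpdateMap_mul hr hext hμ hp hpres (measurable_one.indicator hA)

end SiteMap
/-! ## §2 The reflection through the line of the local field -/

section Reflect

variable {m : Type*} [Fintype m] [DecidableEq m]

/-- **The engine's over-relaxation reflection** through the line of `F`: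
`x ↦ 2⟪F, x⟫/‖F‖² F − x`, and `x` unchanged if `F = 0` (`overrelax_sites` / `overrelax_links`). -/
def reflectThroughLine (F x : EuclideanSpace ℝ m) : EuclideanSpace ℝ m :=
  if F = 0 then x else (2 * ⟪F, x⟫_ℝ / ‖F‖ ^ 2) • F - x

omit [DecidableEq m] in
/-- For `F ≠ 0` it is Mathlib's reflection in the line `ℝ ∙ F`. -/
theorem reflectThroughLine_of_ne_zero {F : EuclideanSpace ℝ m} (hF : F ≠ 0) (x : EuclideanSpace ℝ m) :
    reflectThroughLine F x = (ℝ ∙ F).reflection x := by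
  rw [reflectThroughLine, if_neg hF, Submodule.reflection_apply, Submodule.starProjection_singleton, two_smul,
    ← add_smul]
  congr 2
  simp only [RCLike.ofReal_real_eq_id, id_eq]
  ring

omit [DecidableEq m] in
/-- The reflection preserves the norm. -/
theorem norm_reflectThroughLine (F x : EuclideanSpace ℝ m) : ‖reflectThroughLine F x‖ = ‖x‖ := by
  by_cases hF : F = 0
  · rw [reflectThroughLine, if_pos hF]
  · rw [reflectThroughLine_of_ne_zero hF, LinearIsometryEquiv.norm_map]

omit [DecidableEq m] in
/-- **The reflection preserves the component along `F`**: `⟪R x, F⟫ = ⟪x, F⟫` (so it conserves the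
site / link term of the action). -/
theorem inner_reflectThroughLine_left (F x : EuclideanSpace ℝ m) : ⟪reflectThroughLine F x, F⟫_ℝ = ⟪x, F⟫_ℝ := by
  by_cases hF : F = 0
  · rw [reflectThroughLine, if_pos hF]
  · have hn : ‖F‖ ^ 2 ≠ 0 := pow_ne_zero 2 (norm_ne_zero_iff.2 hF)
    rw [reflectThroughLine, if_neg hF, inner_sub_left, real_inner_smul_left, real_inner_self_eq_norm_sq,
      real_inner_comm F x]
    field_simp
    ring

omit [DecidableEq m] in
/-- The reflection is an involution. -/
theorem reflectThroughLine_reflectThroughLine (F x : EuclideanSpace ℝ m) : reflectThroughLine F (reflectThroughLine F x) = x := by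
  by_cases hF : F = 0
  · rw [reflectThroughLine, if_pos hF, reflectThroughLine, if_pos hF]
  · rw [reflectThroughLine_of_ne_zero hF, reflectThroughLine_of_ne_zero hF, Submodule.reflection_reflection]

omit [DecidableEq m] in
/-- The reflection is jointly measurable in `(F, x)`. -/
theorem measurable_reflectThroughLine₂ :
    Measurable fun p : EuclideanSpace ℝ m × EuclideanSpace ℝ m => reflectThroughLine p.1 p.2 := by
  unfold reflectThroughLine
  refine Measurable.ite (measurable_fst (measurableSet_singleton 0)) measurable_snd ?_
  exact ((((measurable_fst.inner measurable_snd).const_mul 2).div (measurable_fst.norm.pow_const 2)).smul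
    measurable_fst).sub measurable_snd

/-- **The reflection on the unit sphere.** -/
def sphereReflect (F : EuclideanSpace ℝ m) (z : sphere (0 : EuclideanSpace ℝ m) 1) :
    sphere (0 : EuclideanSpace ℝ m) 1 :=
  ⟨reflectThroughLine F z, by rw [mem_sphere_zero_iff_norm, norm_reflectThroughLine, norm_eq_of_mem_sphere z]⟩

omit [DecidableEq m] in
/-- Coordinates of the sphere reflection. -/
@[simp] theorem coe_sphereReflect (F : EuclideanSpace ℝ m) (z : sphere (0 : EuclideanSpace ℝ m) 1) :
    (sphereReflect F z : EuclideanSpace ℝ m) = reflectThroughLine F z := rfl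

omit [DecidableEq m] in
/-- The sphere reflection is jointly measurable. -/
theorem measurable_sphereReflect₂ :
    Measurable fun p : EuclideanSpace ℝ m × sphere (0 : EuclideanSpace ℝ m) 1 => sphereReflect p.1 p.2 :=
  (measurable_reflectThroughLine₂.comp (measurable_fst.prodMk (measurable_subtype_coe.comp measurable_snd))).subtype_mk

variable [Nonempty m]

omit [DecidableEq m] in
/-- **The uniform law of the sphere is invariant under every linear isometry** (through the
Gaussian: `uniformSphere = (stdGaussian).map dirSphere`, `stdGaussian_map`). -/
theorem uniformSphere_map_linearIsometryEquiv (L : EuclideanSpace ℝ m ≃ₗᵢ[ℝ] EuclideanSpace ℝ m)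
    (f : sphere (0 : EuclideanSpace ℝ m) 1 → sphere (0 : EuclideanSpace ℝ m) 1)
    (hf : ∀ z, (f z : EuclideanSpace ℝ m) = L z) :
    (uniformSphere (volume : Measure (EuclideanSpace ℝ m))).map f =
      uniformSphere (volume : Measure (EuclideanSpace ℝ m)) := by
  have hfm : Measurable f := by
    have h : f = fun z => ⟨L z, by rw [mem_sphere_zero_iff_norm, L.norm_map, norm_eq_of_mem_sphere z]⟩ :=
      funext fun z => Subtype.ext (hf z)
    rw [h]
    exact (L.continuous.comp continuous_subtype_val).measurable.subtype_mk
  rw [← stdGaussian_map_dirSphere m, Measure.map_map hfm measurable_dirSphere]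
  have hae : f ∘ dirSphere =ᵐ[stdGaussian (EuclideanSpace ℝ m)] dirSphere ∘ L := by
    filter_upwards [compl_mem_ae_iff.2 (stdGaussian_singleton_zero' (m := m))] with x hx
    have hx' : x ≠ 0 := hx
    have hLx : L x ≠ 0 := fun h => hx' (L.map_eq_zero_iff.1 h)
    apply Subtype.ext
    rw [Function.comp_apply, Function.comp_apply, hf, dirSphere_coe hx', dirSphere_coe hLx, L.norm_map,
      L.map_smul]
  rw [Measure.map_congr hae, ← Measure.map_map measurable_dirSphere L.continuous.measurable, stdGaussian_map L]

omit [DecidableEq m] in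
/-- **The over-relaxation reflection preserves the uniform law of the sphere.** -/
theorem uniformSphere_map_sphereReflect (F : EuclideanSpace ℝ m) :
    (uniformSphere (volume : Measure (EuclideanSpace ℝ m))).map (sphereReflect F) =
      uniformSphere (volume : Measure (EuclideanSpace ℝ m)) := by
  by_cases hF : F = 0
  · have h : sphereReflect F = id := funext fun z => Subtype.ext (by rw [coe_sphereReflect, reflectThroughLine, if_pos hF]; rfl)
    rw [h, Measure.map_id]
  · exact uniformSphere_map_linearIsometryEquiv (ℝ ∙ F).reflection (sphereReflect F)
      fun z => by rw [coe_sphereReflect, reflectThroughLine_of_ne_zero hF]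

end Reflect
/-! ## §3 The `cpn_2d` over-relaxation kernels are exact -/

section CPN

variable {V E : Type*} [Fintype V] [Fintype E] [DecidableEq V] [DecidableEq E] {d : ℕ}
  (src tgt : E → V) (J : EuclideanSpace ℝ (Fin (d + 2)) →L[ℝ] EuclideanSpace ℝ (Fin (d + 2))) (c : E → ℝ)

omit [Fintype V] [DecidableEq E] in
/-- The local field is a continuous function of the configuration. -/
theorem continuous_cpnLocalField (v : V) : Continuous (cpnLocalField src tgt J c v : CPNConfig V E d → _) := by
  unfold cpnLocalField
  have h0 : ∀ e, Continuous fun ω : CPNConfig V E d => linkVec ω e 0 := fun e =>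
    (EuclideanSpace.proj (0 : Fin 2)).continuous.comp (continuous_linkVec e)
  have h1 : ∀ e, Continuous fun ω : CPNConfig V E d => linkVec ω e 1 := fun e =>
    (EuclideanSpace.proj (1 : Fin 2)).continuous.comp (continuous_linkVec e)
  refine (continuous_finsetSum _ fun e _ => ?_).add (continuous_finsetSum _ fun e _ => ?_)
  · refine Continuous.const_smul (Continuous.sub ?_ ?_) (c e)
    · exact (h0 e).smul (continuous_siteVec (tgt e))
    · exact (h1 e).smul (J.continuous.comp (continuous_siteVec (tgt e)))
  · refine Continuous.const_smul (Continuous.sub ?_ ?_) (c e)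
    · exact (h0 e).smul (continuous_siteVec (src e))
    · exact (h1 e).smul ((ContinuousLinearMap.adjoint J).continuous.comp (continuous_siteVec (src e)))

omit [Fintype V] [Fintype E] [DecidableEq V] [DecidableEq E] in
/-- The staple is a continuous function of the configuration. -/
theorem continuous_cpnStaple (e : E) : Continuous (cpnStaple src tgt J c e : CPNConfig V E d → _) := by
  unfold cpnStaple
  refine (PiLp.continuous_toLp 2 _).comp ?_
  refine continuous_pi fun j => ?_
  fin_cases j
  · exact continuous_const.mul ((continuous_siteVec (src e)).inner (continuous_siteVec (tgt e)))
  · exact (continuous_const.mul ((continuous_siteVec (src e)).inner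
      (J.continuous.comp (continuous_siteVec (tgt e))))).neg

/-- The site reflection map of `v`: reflect `z_v` through the line of the local field `F_v(ω)`. -/
def cpnSiteReflect (v : V) (ω : CPNConfig V E d) (ξ : CPNVar V E d (Sum.inl v)) : CPNVar V E d (Sum.inl v) :=
  sphereReflect (m := Fin (d + 2)) (cpnLocalField src tgt J c v ω) ξ

/-- The link reflection map of `e`: reflect `λ_e` through the line of the staple `b_e(ω)`. -/
def cpnLinkReflect (e : E) (ω : CPNConfig V E d) (ℓ : CPNVar V E d (Sum.inr e)) : CPNVar V E d (Sum.inr e) :=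
  sphereReflect (m := Fin 2) (cpnStaple src tgt J c e ω) ℓ

omit [DecidableEq E] in
/-- Joint measurability of the site reflection. -/
theorem measurable_cpnSiteReflect (v : V) :
    Measurable fun p : CPNConfig V E d × CPNVar V E d (Sum.inl v) => cpnSiteReflect src tgt J c v p.1 p.2 :=
  measurable_sphereReflect₂.comp
    (((continuous_cpnLocalField src tgt J c v).measurable.comp measurable_fst).prodMk measurable_snd)

omit [DecidableEq V] [DecidableEq E] in
/-- Joint measurability of the link reflection. -/
theorem measurable_cpnLinkReflect (e : E) :
    Measurable fun p : CPNConfig V E d × CPNVar V E d (Sum.inr e) => cpnLinkReflect src tgt J c e p.1 p.2 :=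
  measurable_sphereReflect₂.comp
    (((continuous_cpnStaple src tgt J c e).measurable.comp measurable_fst).prodMk measurable_snd)

/-- **The site over-relaxation kernel** of `cpn_2d.overrelax_sites` at site `v` (deterministic). -/
def cpnSiteOR (v : V) : Kernel (CPNConfig V E d) (CPNConfig V E d) :=
  Kernel.deterministic (siteUpdateMap (Sum.inl v) (cpnSiteReflect src tgt J c v))
    (measurable_siteUpdateMap (measurable_cpnSiteReflect src tgt J c v))

/-- **The link over-relaxation kernel** of `cpn_2d.overrelax_links` at link `e` (deterministic). -/
def cpnLinkOR (e : E) : Kernel (CPNConfig V E d) (CPNConfig V E d) :=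
  Kernel.deterministic (siteUpdateMap (Sum.inr e) (cpnLinkReflect src tgt J c e))
    (measurable_siteUpdateMap (measurable_cpnLinkReflect src tgt J c e))

variable {src tgt}

/-- **THE SITE OVER-RELAXATION MOVE IS EXACT** (no self-loops): it leaves `e^{−S} · ⊗ cpnRef`
invariant — the reflection preserves the uniform law of the site sphere and the site's conditional
weight `e^{⟨z_v, F_v⟩}`. -/
theorem cpnSiteOR_invariant (hloop : ∀ e, src e ≠ tgt e) (v : V) :
    Kernel.Invariant (cpnSiteOR src tgt J c v)
      ((Measure.pi (cpnRef V E d)).withDensity (gibbsDensity (cpnAction src tgt J c))) := by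
  refine siteUpdateMap_invariant (measurable_cpnSiteReflect src tgt J c v) (fun ω ξ => ?_) (fun ω => ?_)
    (measurable_gibbsDensity (continuous_cpnAction src tgt J c)) (fun ω ξ => ?_)
  · funext ζ
    exact congrArg (fun F => sphereReflect (m := Fin (d + 2)) F ζ) (localField_update J c hloop v ω ξ)
  · exact uniformSphere_map_sphereReflect _
  · rw [gibbsDensity_cpnAction_update J c hloop, gibbsDensity_cpnAction_update J c hloop,
      siteVec_update_self, siteVec_update_self]
    exact congrArg (fun a : ℝ => ENNReal.ofReal (Real.exp a) *
      ENNReal.ofReal (Real.exp (-cpnRestAction src tgt J c v ω))) (inner_reflectThroughLine_left _ _)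

/-- **THE LINK OVER-RELAXATION MOVE IS EXACT**: it leaves `e^{−S} · ⊗ cpnRef` invariant. -/
theorem cpnLinkOR_invariant (e : E) :
    Kernel.Invariant (cpnLinkOR src tgt J c e)
      ((Measure.pi (cpnRef V E d)).withDensity (gibbsDensity (cpnAction src tgt J c))) := by
  refine siteUpdateMap_invariant (measurable_cpnLinkReflect src tgt J c e) (fun ω ℓ => ?_) (fun ω => ?_)
    (measurable_gibbsDensity (continuous_cpnAction src tgt J c)) (fun ω ℓ => ?_)
  · funext ζ
    exact congrArg (fun b => sphereReflect (m := Fin 2) b ζ) (cpnStaple_update J c e ω ℓ)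
  · exact uniformSphere_map_sphereReflect _
  · rw [gibbsDensity_cpnAction_update_link J c e, gibbsDensity_cpnAction_update_link J c e,
      linkVec_update_self, linkVec_update_self]
    exact congrArg (fun a : ℝ => ENNReal.ofReal (Real.exp a) *
      ENNReal.ofReal (Real.exp (-cpnLinkRest src tgt J c e ω))) (inner_reflectThroughLine_left _ _)

variable (src tgt)

/-- The over-relaxation kernel of a site or a link. -/
def cpnOR : V ⊕ E → Kernel (CPNConfig V E d) (CPNConfig V E d)
  | Sum.inl v => cpnSiteOR src tgt J c v
  | Sum.inr e => cpnLinkOR src tgt J c e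

/-- Each over-relaxation kernel is Markov (deterministic). -/
instance isMarkovKernel_cpnOR (i : V ⊕ E) : IsMarkovKernel (cpnOR src tgt J c i) := by
  cases i <;> · unfold cpnOR cpnSiteOR cpnLinkOR; infer_instance

/-- **An over-relaxation schedule**: the moves of a list of sites and links composed (e.g. `n_or` full
`'or'` sweeps concatenated). -/
def cpnORSweep (l : List (V ⊕ E)) : Kernel (CPNConfig V E d) (CPNConfig V E d) :=
  cycle (l.map (cpnOR src tgt J c))

/-- An over-relaxation schedule is Markov. -/
instance isMarkovKernel_cpnORSweep (l : List (V ⊕ E)) : IsMarkovKernel (cpnORSweep src tgt J c l) :=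
  isMarkovKernel_cycle fun κ hκ => by
    obtain ⟨i, -, rfl⟩ := List.mem_map.1 hκ
    infer_instance

variable {src tgt}

/-- **Every over-relaxation schedule is exact** (no self-loops). -/
theorem cpnORSweep_invariant (hloop : ∀ e, src e ≠ tgt e) (l : List (V ⊕ E)) :
    Kernel.Invariant (cpnORSweep src tgt J c l)
      ((Measure.pi (cpnRef V E d)).withDensity (gibbsDensity (cpnAction src tgt J c))) := by
  refine invariant_cycle fun κ hκ => ?_
  obtain ⟨i, -, rfl⟩ := List.mem_map.1 hκ
  cases i with
  | inl v => exact cpnSiteOR_invariant J c hloop v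
  | inr e => exact cpnLinkOR_invariant J c e

/-! ## §4 The composites converge to the lattice CP(N−1) law from every start -/

/-- **`composite_sweep` WITH THE HEAT BATH: a heat-bath scan through every site and link followed by
any over-relaxation schedule converges to `cpnGibbsLaw` from EVERY initial law**, geometrically in
total variation. -/
theorem cpn_heatBath_overrelax_uniformlyErgodic (hloop : ∀ e, src e ≠ tgt e) {l : List (V ⊕ E)}
    (hl : ∀ i, i ∈ l) (lor : List (V ⊕ E)) :
    ∃ ε : ℝ, 0 < ε ∧ ε ≤ 1 ∧ ∀ (μ₀ : Measure (CPNConfig V E d)) [IsProbabilityMeasure μ₀] (t : ℕ)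
      (A : Set (CPNConfig V E d)),
      |((fun ν : Measure (CPNConfig V E d) => ν.bind (cpnORSweep src tgt J c lor ∘ₖ
          cycle (l.map (siteHeatBath (cpnRef V E d) (gibbsDensity (cpnAction src tgt J c))))))^[t] μ₀).real A
          - (cpnGibbsLaw src tgt J c).real A| ≤ (1 - ε) ^ t :=
  cpn_heatBathSweep_comp_uniformlyErgodic src tgt J c hl _ (cpnORSweep_invariant J c hloop lor)

/-- **`composite_sweep` WITH METROPOLIS: a Metropolis scan (kick sizes `εs, εl > 0`) through every
site and link followed by any over-relaxation schedule converges to `cpnGibbsLaw` from EVERY initial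
law**, geometrically in total variation. -/
theorem cpn_metropolis_overrelax_uniformlyErgodic (hloop : ∀ e, src e ≠ tgt e) {εs εl : ℝ}
    (hεs : 0 < εs) (hεl : 0 < εl) {l : List (V ⊕ E)} (hl : ∀ i, i ∈ l) (lor : List (V ⊕ E)) :
    ∃ δ : ℝ, 0 < δ ∧ δ ≤ 1 ∧ ∀ (μ₀ : Measure (CPNConfig V E d)) [IsProbabilityMeasure μ₀] (t : ℕ)
      (A : Set (CPNConfig V E d)),
      |((fun ν : Measure (CPNConfig V E d) => ν.bind (cpnORSweep src tgt J c lor ∘ₖ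
          cpnMetropolisSweep src tgt J c εs εl l))^[t] μ₀).real A
          - (cpnGibbsLaw src tgt J c).real A| ≤ (1 - δ) ^ t :=
  cpn_metropolisSweep_comp_uniformlyErgodic src tgt J c hεs hεl hl _ (cpnORSweep_invariant J c hloop lor)

end CPN

end Summit.Ventures.LatticeQCDFlow.Exactness
end
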